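import Literature.Analysis.FluidPDE.CKNLocalRegularityRRSStep3
import HarnessLib

/-!
# A Caffarelli–Kohn–Nirenberg induction from the initial time, Step 3
(towards Barker–Prange 2020, Thm. 1 in the slab form used for Thm. 2)

Analysis/FluidPDE proofs file (theorems only, no definitions, no named facts) on the discharge
path of the named fact `Literature.Analysis.FluidPDE.BarkerPrange2020_thm2`
(`BarkerPrangeConcentration.lean`; T. Barker, C. Prange, Arch. Ration. Mech. Anal. 236 (2020) =
arXiv:1812.09115, Thm. 2), which the tree has reduced to the paper's Thm. 1 in slab form
(`BarkerPrange2020_thm2_of_thm1`, `BarkerPrangeConcentrationOfThm1.lean`): a local energy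
solution on `ℝ³ × (0, S)` whose datum is bounded by `M` in `L²_uloc` and small in `L³(B₂(0))` is
essentially bounded on `(β, S) × B_{1/3}(0)` for every `β > 0`, for a suitable `S = S(M)`.

## The road taken (a deviation from the printed proof, recorded)

Barker–Prange prove Thm. 1 by a perturbation argument (§§2–4: Bogovskii cut-off of the datum,
the mild solution `a` of the localised datum, an ε-regularity theory for the Navier–Stokes
equations perturbed by the *critical* drift `a ∈ L⁵`, and a bootstrap for the perturbed Stokes
system); none of that perturbed theory is in the tree. The tree does contain, fully proved, the
one-scale ε-regularity theorem of Caffarelli–Kohn–Nirenberg in Robinson–Rodrigo–Sadowski's form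
(`RRS2016.theorem15_3_force_holds`, with its Lemma 15.11 — the test functions `φ_n` — and
Lemma 15.12 — the local pressure estimate —, the interpolation inequality
`interpolationEstimate_holds`, and `oneScaleRegularity_holds`) and the local energy inequality of
a local energy solution **from the initial time** (`IsLocalEnergySolutionOn.localEnergyIneq_initial`).
With these, the slab form of Thm. 1 follows from a Caffarelli–Kohn–Nirenberg induction run
**from the initial time in the scale-invariant normalisation**: for the solution extended by zero
to negative times, the local energy inequality on a cylinder `Q_1(z₀)` meeting `{t = 0}` holds
with the extra datum term `∫ |u₀|² φ(0, ·)`, which for `u₀ ∈ L³` (indeed for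
`sup_ρ ρ⁻¹ ∫_{B_ρ} |u₀|²` small) is *scale-invariantly small* at every dyadic scale; hence the
smallness — not the decay — of `C(r_n) + D(r_n)` propagates from the unit scale down to all
scales `r_n = 2⁻ⁿ`, and at the scales `r_n² ≤ t` the cylinders `Q_{r_n}(t, x̄)` lie inside the
open slab, where the proved one-scale ε-regularity theorem applies. (This is, in substance, an
"ε-regularity criterion in terms of the initial data" in the sense of Kang–Miura–Tsai, Pure Appl.
Anal. 3 (2021) = arXiv:2006.13145, Thm. 1.1 and Remark 1.2 (1) — smallness of the scaled local
`L²` norm `sup_r r⁻¹ ∫_{B_r} |v₀|²` of the datum gives regularity for a short time —, here with the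
smallness at every centre of `B_{1/2}` and a slab instead of a paraboloid as the regular region;
for the qualitative slab statement it replaces Barker–Prange's §§2–3 entirely.)

The induction is that of Robinson–Rodrigo–Sadowski 2016, proof of Thm. 15.3, Steps 1–3
(`CKNLocalRegularityRRS*.lean`), with the bounds

* `(A'_n)`: `C(r_n) + D_osc(r_n) ≤ ε₀^{2/3}` (`cknC`, `cknDOsc`: no decay in `n`),
* `(B'_n)`: `A_ess(r_n) + E(r_n) ≤ C_B ε₀^{2/3}` (`cknAEss`, `cknE`),

in place of the decaying `(A_n)`, `(B_n)` of (15.21)–(15.22). This file proves **Step 3** of that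
induction, `{(B'_k)}_{2 ≤ k ≤ n} ⟹ (A'_n)`:

* `BarkerPrange2020.initialStep3` — for every `C_B ≥ 1` there is `ε₁(C_B) > 0` such that, for a
  velocity `u` with weak spatial gradient `G` on `Q_1(z₀)`, a locally integrable pressure `p`
  satisfying the pressure equation `-Δp = ∂ᵢ∂ⱼ(uᵢuⱼ)` in `𝒟'(Q_1(z₀))`, the one-scale smallness
  `∫∫_{Q_1(z₀)} (|u|³ + |p|^{3/2}) ≤ ε₀ ≤ ε₁`, a point `z ∈ Q_{1/2}(z₀)` and `n ≥ 2`: if `(B'_k)` holds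
  at `z` for `2 ≤ k ≤ n` then `(A'_n)` holds at `z`.

Only the pressure equation, the weak gradient and the integrability classes are used (no local
energy inequality, no equation of motion): exactly the hypotheses available for the zero
extension of a local energy solution across `t = 0`.

## Proof (RRS pp. 223–225 in the scale-invariant normalisation)

With `m = ε₀^{1/3}`, `c₀ = C₀ + 1`, `K₁ = 4 c₀ C_B² + 16`, `K = K₁ + 2 C_B² + 8224`,
`ε₁ = min(1/(2 c₀ C_B²), 1/(2 C₂ K))³`:
*velocity* — interpolation on `Q_{r_k}(z)` and `(B'_k)` give `C(r_k) ≤ C₀ (C_B m²)^{3/2} ≤ c₀ C_B² m³`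
(`2 ≤ k ≤ n`), which at `k = n` is `≤ m²/2`; *pressure* — Lemma 15.12 on `Q_{1/2}(z)` with
`r = r_n`: for a.e. `t ∈ (s - r_n², s)`,
`∫_{B_{r_n}} |p - (p)_{r_n}|^{3/2} ≤ C₂ ∫_{B_{2r_n}} |u(t)|³ + C₂ r_n^{9/2} T(t)^{3/2} + C₂ 2^{9/2} r_n^{9/2} W(t)`;
the annulus `{2 r_n < |y - a| < 1/2}` is the union of the rings `{r_{j+1} ≤ |y-a| < r_j}`,
`1 ≤ j ≤ n-2`; on the `j`-th ring, `j ≥ 2`, `(B'_j)` gives `∫_{B_{r_j}} |u(t)|² ≤ C_B m² r_j`, so these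
rings contribute `≤ 16 C_B m² Σ_j 8^j ≤ (2/7) C_B m² r_n⁻³`, the outermost ring `≤ 256 ∫_{B_{1/2}} |u(t)|²`
(Hölder in time, RRS repair 2 of `CKNLocalRegularityRRS`); hence, with `ρ = r_n^{1/2}`,
`T^{3/2} ≤ 2 (C_B² m³ ρ⁻⁹ + 4096 W)`; integrating over `(s - r_n², s)` (length `ρ⁴`),
`∫∫ |u|³` over `(s-r_n²,s) × B_{r_{n-1}}` is `≤ r_{n-1}² C(r_{n-1}) ≤ 4 c₀ C_B² m³ r_n²` (`n ≥ 3`;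
`≤ ε₀ = 16 m³ r_2²` for `n = 2`), `∫ W ≤ ε₀`; altogether
`∫∫_{Q_{r_n}} |p - (p)_{r_n}|^{3/2} ≤ C₂ K m³ ρ⁴`, i.e. `D_osc(r_n) ≤ C₂ K m³ ≤ m²/2`.
All terms are `O(ε₀)` against the target `ε₀^{2/3}`: the gain `ε₀^{1/3}` (a cubic quantity estimated
by the `3/2`-power of quadratic ones) closes the induction without any decay in `n`.

## References

* T. Barker, C. Prange, Arch. Ration. Mech. Anal. 236 (2020) 1487–1541 = arXiv:1812.09115,
  Thm. 1, Thm. 2, §4. [BarkerPrange2020]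
* J. C. Robinson, J. L. Rodrigo, W. Sadowski, *The three-dimensional Navier–Stokes equations*,
  CUP (2016), proof of Thm. 15.3, Step 3 (pp. 223–225), Lemma 15.10, Lemma 15.12.
  [RobinsonRodrigoSadowski2016]
* L. Caffarelli, R. Kohn, L. Nirenberg, Comm. Pure Appl. Math. 35 (1982), Proposition 1.
* K. Kang, H. Miura, T.-P. Tsai, IMRN 2021 = arXiv:1812.10509, Thm. 1.1 (the bound
  `|v| ≤ C t^{-1/2}` for local energy solutions with locally `L³` data). [KangMiuraTsai2020]
* K. Kang, H. Miura, T.-P. Tsai, *An ε-regularity criterion and estimates of the regular set for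
  Navier–Stokes flows in terms of initial data*, Pure Appl. Anal. 3 (2021) = arXiv:2006.13145,
  Thm. 1.1, Remark 1.2.
-/

noncomputable section

open MeasureTheory Set Function Filter Topology TopologicalSpace Metric
open scoped NNReal ENNReal InnerProductSpace RealInnerProductSpace Laplacian

namespace Literature.Analysis.FluidPDE

namespace BarkerPrange2020

open RRS2016

/-- Geometric sum for the ring decomposition in the scale-invariant normalisation:
`Σ_{2 ≤ j < N} 8^j ≤ 8^N / 7`. [folklore] -/
theorem sum_Ico_eight_pow_le (N : ℕ) :
    ∑ j ∈ Finset.Ico 2 N, (8 : ℝ) ^ j ≤ 8 ^ N / 7 := by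
  induction N with
  | zero => simp
  | succ N ih =>
      rcases Nat.lt_or_ge N 2 with hN | hN
      · have : Finset.Ico 2 (N + 1) = ∅ := Finset.Ico_eq_empty_of_le (by omega)
        rw [this, Finset.sum_empty]; positivity
      · rw [Finset.sum_Ico_succ_top hN]
        have h2 : (8 : ℝ) ^ (N + 1) = 8 * 8 ^ N := by ring
        rw [h2]
        linarith [ih]

/-- Restriction of the weak pressure equation `-Δp = ∂ᵢ∂ⱼ(uᵢuⱼ)` from an open set to an open
subset (test functions on the subset are test functions on the set, and the integrand vanishes
off the support). [folklore] -/
theorem pressureEq_mono {Q Q' : Opens (ℝ × EuclideanSpace ℝ (Fin 3))}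
    {u : ℝ → EuclideanSpace ℝ (Fin 3) → EuclideanSpace ℝ (Fin 3)}
    {p : ℝ → EuclideanSpace ℝ (Fin 3) → ℝ}
    (h : ∀ φ : ℝ → EuclideanSpace ℝ (Fin 3) → ℝ, IsSpaceTimeTestOn Q φ →
      ∫ w in (Q : Set (ℝ × EuclideanSpace ℝ (Fin 3))),
        (⟪u w.1 w.2, convect (u w.1) (gradient (φ w.1)) w.2⟫ + p w.1 w.2 * Δ (φ w.1) w.2) = 0)
    (hle : Q' ≤ Q) :
    ∀ φ : ℝ → EuclideanSpace ℝ (Fin 3) → ℝ, IsSpaceTimeTestOn Q' φ →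
      ∫ w in (Q' : Set (ℝ × EuclideanSpace ℝ (Fin 3))),
        (⟪u w.1 w.2, convect (u w.1) (gradient (φ w.1)) w.2⟫ + p w.1 w.2 * Δ (φ w.1) w.2) = 0 := by
  intro φ hφ
  have hQs : ((Q' : Opens (ℝ × EuclideanSpace ℝ (Fin 3))) : Set (ℝ × EuclideanSpace ℝ (Fin 3))) ⊆
      (Q : Set (ℝ × EuclideanSpace ℝ (Fin 3))) := hle
  have key := h φ (hφ.mono hle)
  rw [setIntegral_eq_of_subset_of_forall_sdiff_eq_zero Q.isOpen.measurableSet hQs] at key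
  · exact key
  · rintro ⟨t, x⟩ hz
    have h1 : convect (u t) (gradient (φ t)) x = 0 := hφ.convect_gradient_eq_zero hz.2 _
    have h2 : Δ (φ t) x = 0 := hφ.laplacian_slice_eq_zero hz.2
    rw [h1, h2, inner_zero_right, mul_zero, add_zero]

set_option maxHeartbeats 1600000 in
/-- **Step 3 of the initial-time induction** (`{(B'_k)}_{2 ≤ k ≤ n} ⟹ (A'_n)` in the
scale-invariant normalisation; Robinson–Rodrigo–Sadowski 2016, proof of Thm. 15.3, Step 3,
pp. 223–225, run with `(B'_k) : A_ess(r_k) + E(r_k) ≤ C_B ε₀^{2/3}` and concluding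
`(A'_n) : C(r_n) + D_osc(r_n) ≤ ε₀^{2/3}`). Hypotheses: `u` has the weak spatial gradient `G` on
`Q_1(z₀)`; `p` is locally integrable on `Q_1(z₀)` and `-Δp = ∂ᵢ∂ⱼ(uᵢuⱼ)` in `𝒟'(Q_1(z₀))`;
`∫∫_{Q_1(z₀)} (|u|³ + |p|^{3/2}) ≤ ε₀ ≤ ε₁(C_B)`; `z ∈ Q_{1/2}(z₀)`, `n ≥ 2`. The interpolation
inequality (Lemma 15.10) and the local pressure estimate (Lemma 15.12) enter as the accepted
statements `interpolationEstimate`, `RRS2016.lemma15_12` (both discharged in the tree). See the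
module docstring for the constants. [cite: RobinsonRodrigoSadowski2016, proof of Thm. 15.3, Step 3, pp. 223–225; BarkerPrange2020, Thm. 1] -/
theorem initialStep3 (hI : interpolationEstimate) (h12 : lemma15_12) :
    ∀ CB : ℝ, 1 ≤ CB → ∃ ε₁ : ℝ, 0 < ε₁ ∧
      ∀ (z₀ : ℝ × EuclideanSpace ℝ (Fin 3))
        (u : ℝ → EuclideanSpace ℝ (Fin 3) → EuclideanSpace ℝ (Fin 3))
        (p : ℝ → EuclideanSpace ℝ (Fin 3) → ℝ)
        (G : ℝ → EuclideanSpace ℝ (Fin 3) → EuclideanSpace ℝ (Fin 3) →L[ℝ] EuclideanSpace ℝ (Fin 3)),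
        HasWeakSpatialGradientOn (parabolicCylinderOpens 1 z₀) u G →
        LocallyIntegrableOn (uncurry p) (parabolicCylinder 1 z₀) volume →
        (∀ φ : ℝ → EuclideanSpace ℝ (Fin 3) → ℝ, IsSpaceTimeTestOn (parabolicCylinderOpens 1 z₀) φ →
          ∫ w in parabolicCylinder 1 z₀,
            (⟪u w.1 w.2, convect (u w.1) (gradient (φ w.1)) w.2⟫ + p w.1 w.2 * Δ (φ w.1) w.2) = 0) →
        ∀ ε₀ : ℝ, 0 < ε₀ → ε₀ ≤ ε₁ → Small ε₀ u p z₀ →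
          ∀ z ∈ parabolicCylinder (1 / 2) z₀, ∀ n : ℕ, 2 ≤ n →
            (∀ k : ℕ, 2 ≤ k → k ≤ n →
              cknAEss (rad k) z u + cknE (rad k) z G ≤ ENNReal.ofReal (CB * ε₀ ^ (2 / 3 : ℝ))) →
            cknC (rad n) z u + cknDOsc (rad n) z p ≤ ENNReal.ofReal (ε₀ ^ (2 / 3 : ℝ)) := by
  obtain ⟨C₀, HC₀⟩ := hI
  obtain ⟨C₂, hC₂, H12⟩ := h12
  intro CB hCB
  have hCB0 : 0 < CB := lt_of_lt_of_le one_pos hCB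
  -- constants
  set c₀ : ℝ := (C₀ : ℝ) + 1 with hc₀
  have hc₀0 : 0 < c₀ := by positivity
  have hC₀c₀ : (C₀ : ℝ) ≤ c₀ := by simp [hc₀]
  set K₁ : ℝ := 4 * c₀ * CB ^ 2 + 16 with hK₁
  set K : ℝ := K₁ + 2 * CB ^ 2 + 8224 with hK
  have hK₁0 : 0 < K₁ := by positivity
  have hK0 : 0 < K := by positivity
  set δ : ℝ := min (1 / (2 * c₀ * CB ^ 2)) (1 / (2 * C₂ * K)) with hδ
  have hδ0 : 0 < δ := lt_min (by positivity) (by positivity)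
  refine ⟨δ ^ 3, by positivity, ?_⟩
  intro z₀ u p G hG hpli hPeq ε₀ hε₀ hε₀₁ hsmall z hz n hn hBk
  -- real parameters `m = ε₀^{1/3}`, `ρ = r_n^{1/2}`
  set m : ℝ := ε₀ ^ (1 / 3 : ℝ) with hm
  have hm0 : 0 < m := Real.rpow_pos_of_pos hε₀ _
  have hm3 : m ^ 3 = ε₀ := by
    rw [hm, ← Real.rpow_natCast, ← Real.rpow_mul hε₀.le]; norm_num
  have hm2 : ε₀ ^ (2 / 3 : ℝ) = m ^ 2 := by
    rw [hm, ← Real.rpow_natCast, ← Real.rpow_mul hε₀.le]; norm_num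
  have hmδ : m ≤ δ := by
    refine le_of_pow_le_pow_left₀ (n := 3) (by norm_num) hδ0.le ?_
    rw [hm3]; exact hε₀₁
  have hm_u : m ≤ 1 / (2 * c₀ * CB ^ 2) := hmδ.trans (min_le_left _ _)
  have hm_p : m ≤ 1 / (2 * C₂ * K) := hmδ.trans (min_le_right _ _)
  set rn : ℝ := rad n with hrn
  have hrn0 : 0 < rn := rad_pos n
  have hrn4 : rn ≤ 1 / 4 := by rw [hrn, ← rad_two]; exact rad_antitone hn
  have hrn1 : rn ≤ 1 := by linarith
  set ρ : ℝ := Real.sqrt rn with hρ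
  have hρ0 : 0 < ρ := Real.sqrt_pos.2 hrn0
  have hρ2 : ρ ^ 2 = rn := Real.sq_sqrt hrn0.le
  have hρ1 : ρ ≤ 1 := by
    rw [hρ, ← Real.sqrt_one]; exact Real.sqrt_le_sqrt hrn1
  have hrn_92 : rn ^ (9 / 2 : ℝ) = ρ ^ 9 := by
    rw [← hρ2, ← Real.rpow_natCast ρ 2, ← Real.rpow_mul hρ0.le, ← Real.rpow_natCast ρ 9]
    norm_num
  have hrad_pred : rad (n - 1) = 2 * rn := by
    have : rad n = rad (n - 1 + 1) := by rw [Nat.sub_add_cancel (by omega)]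
    rw [hrn, this, rad_succ]; ring
  -- geometry and measurability
  have hzQ : ∀ {r : ℝ}, 0 < r → r ≤ 1 / 2 → parabolicCylinder r z ⊆ parabolicCylinder 1 z₀ :=
    fun hr hr2 => parabolicCylinder_subset_of_mem_half hz hr hr2
  have hu1 : AEStronglyMeasurable (uncurry u) (volume.restrict (parabolicCylinder 1 z₀)) :=
    hG.locallyIntegrableOn.aestronglyMeasurable
  have hp1 : AEStronglyMeasurable (uncurry p) (volume.restrict (parabolicCylinder 1 z₀)) :=
    hpli.aestronglyMeasurable
  have hres : ∀ {r : ℝ}, 0 < r → r ≤ 1 / 2 →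
      volume.restrict (parabolicCylinder r z) ≤ volume.restrict (parabolicCylinder 1 z₀) :=
    fun hr hr2 => Measure.restrict_mono (hzQ hr hr2) le_rfl
  have huh : AEStronglyMeasurable (uncurry u) (volume.restrict (parabolicCylinder (1 / 2) z)) :=
    hu1.mono_measure (hres (by norm_num) le_rfl)
  have hph : AEStronglyMeasurable (uncurry p) (volume.restrict (parabolicCylinder (1 / 2) z)) :=
    hp1.mono_measure (hres (by norm_num) le_rfl)
  -- (1) the velocity bounds `C(r_k) ≤ c₀ C_B² m³` from `(B'_k)` and interpolation
  have hCk : ∀ k, 2 ≤ k → k ≤ n →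
      cknC (rad k) z u ≤ ENNReal.ofReal (c₀ * CB ^ 2 * m ^ 3) := by
    intro k hk2 hkn
    have hBkk := hBk k hk2 hkn
    have hle : parabolicCylinderOpens (rad k) z ≤ parabolicCylinderOpens 1 z₀ :=
      parabolicCylinder_rad_subset hz (by omega)
    have hGk := hG.mono hle
    have hfinA : cknAEss (rad k) z u ≠ ∞ :=
      ne_top_of_le_ne_top ENNReal.ofReal_ne_top (le_trans le_self_add hBkk)
    have hfinE : cknE (rad k) z G ≠ ∞ :=
      ne_top_of_le_ne_top ENNReal.ofReal_ne_top (le_trans le_add_self hBkk)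
    have h1 := HC₀ u G z (rad k) (rad_pos k) hGk hfinA hfinE
    have hreal : (C₀ : ℝ) * (CB * ε₀ ^ (2 / 3 : ℝ)) ^ (3 / 2 : ℝ) ≤ c₀ * CB ^ 2 * m ^ 3 := by
      have e1 : (CB * ε₀ ^ (2 / 3 : ℝ)) ^ (3 / 2 : ℝ) = CB ^ (3 / 2 : ℝ) * m ^ 3 := by
        rw [hm2, Real.mul_rpow (by positivity) (by positivity)]
        congr 1
        rw [← Real.rpow_natCast m 2, ← Real.rpow_mul hm0.le, ← Real.rpow_natCast m 3]
        norm_num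
      have e2 : CB ^ (3 / 2 : ℝ) ≤ CB ^ 2 := by
        rw [← Real.rpow_natCast CB 2]
        exact Real.rpow_le_rpow_of_exponent_le hCB (by norm_num)
      rw [e1]
      have hx : 0 ≤ CB ^ (3 / 2 : ℝ) * m ^ 3 :=
        mul_nonneg (Real.rpow_nonneg hCB0.le _) (pow_pos hm0 3).le
      calc (C₀ : ℝ) * (CB ^ (3 / 2 : ℝ) * m ^ 3)
          ≤ c₀ * (CB ^ 2 * m ^ 3) :=
            mul_le_mul hC₀c₀ (mul_le_mul_of_nonneg_right e2 (pow_pos hm0 3).le) hx hc₀0.le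
        _ = _ := by ring
    calc cknC (rad k) z u ≤ C₀ * (cknAEss (rad k) z u + cknE (rad k) z G) ^ (3 / 2 : ℝ) := h1
      _ ≤ C₀ * (ENNReal.ofReal (CB * ε₀ ^ (2 / 3 : ℝ))) ^ (3 / 2 : ℝ) := by
          gcongr
      _ = ENNReal.ofReal ((C₀ : ℝ) * (CB * ε₀ ^ (2 / 3 : ℝ)) ^ (3 / 2 : ℝ)) := by
          rw [ENNReal.ofReal_mul (NNReal.coe_nonneg _), ENNReal.ofReal_coe_nnreal,
            ENNReal.ofReal_rpow_of_nonneg (by positivity) (by norm_num)]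
      _ ≤ ENNReal.ofReal (c₀ * CB ^ 2 * m ^ 3) := ENNReal.ofReal_le_ofReal hreal
  -- (2) the slice energy bounds from `(B'_j)`: `∫_{B_{r_j}} |u(t)|² ≤ C_B m² r_j`
  have hslice : ∀ᵐ t : ℝ, ∀ j : ℕ, 2 ≤ j → j ≤ n → t ∈ Ioo (z.1 - rad j ^ 2) z.1 →
      ∫⁻ x in ball z.2 (rad j), ‖u t x‖ₑ ^ 2 ≤ ENNReal.ofReal (CB * m ^ 2 * rad j) := by
    refine ae_all_iff.2 fun j => ?_
    by_cases hj : 2 ≤ j ∧ j ≤ n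
    · have hBj := hBk j hj.1 hj.2
      have hrj := rad_pos j
      have hA : cknAEss (rad j) z u ≤ ENNReal.ofReal (CB * m ^ 2 / rad j ^ 2 * rad j ^ 2) := by
        rw [div_mul_cancel₀ _ (pow_pos hrj 2).ne', ← hm2]; exact le_trans le_self_add hBj
      filter_upwards [ae_ball_sq_le_of_cknAEss_le hrj hA] with t ht _ _ htI
      have := ht htI
      rwa [show CB * m ^ 2 / rad j ^ 2 * rad j ^ 3 = CB * m ^ 2 * rad j by
        field_simp] at this
    · exact ae_of_all _ fun t h1 h2 => absurd ⟨h1, h2⟩ hj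
  -- (3) Lemma 15.12 on `Q_{1/2}(z)` with `r = r_n`
  have hU3 : ∫⁻ w in parabolicCylinder (1 / 2) z, ‖u w.1 w.2‖ₑ ^ (3 : ℕ) < ∞ :=
    lt_of_le_of_lt ((lintegral_mono fun w => le_self_add).trans
      ((lintegral_mono_set (hzQ (by norm_num) le_rfl)).trans hsmall)) ENNReal.ofReal_lt_top
  have hP32 : ∫⁻ w in parabolicCylinder (1 / 2) z, ‖p w.1 w.2‖ₑ ^ (3 / 2 : ℝ) < ∞ :=
    lt_of_le_of_lt ((lintegral_mono fun w => le_add_self).trans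
      ((lintegral_mono_set (hzQ (by norm_num) le_rfl)).trans hsmall)) ENNReal.ofReal_lt_top
  have hleh : parabolicCylinderOpens (1 / 2) z ≤ parabolicCylinderOpens 1 z₀ :=
    hzQ (by norm_num) le_rfl
  have hPeqh := pressureEq_mono (Q := parabolicCylinderOpens 1 z₀)
    (Q' := parabolicCylinderOpens (1 / 2) z) hPeq hleh
  have h12ae := H12 z (1 / 2) u p (by norm_num) huh hph hU3 hP32 hPeqh rn hrn0 (by linarith)
  -- the time interval of `Q_{r_n}(z)` and the slices of `u` on `B_{1/2}(a)`
  set In : Set ℝ := Ioo (z.1 - rn ^ 2) z.1 with hIn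
  have hInsub : In ⊆ Ioo (z.1 - (1 / 2) ^ 2) z.1 := Ioo_subset_Ioo (by nlinarith) le_rfl
  have hslm : ∀ᵐ t ∂(volume.restrict (Ioo (z.1 - (1 / 2) ^ 2) z.1)),
      AEStronglyMeasurable (fun x => u t x) (volume.restrict (ball z.2 (1 / 2))) := by
    have huh' : AEStronglyMeasurable (uncurry u)
        ((volume.restrict (Ioo (z.1 - (1 / 2) ^ 2) z.1)).prod (volume.restrict (ball z.2 (1 / 2)))) := by
      rw [← volume_restrict_parabolicCylinder]; exact huh
    filter_upwards [huh'.prodMk_left] with t ht using ht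
  -- (4) the slice-wise bound on `(s - r_n², s)`
  have h22 : (2 : ℝ≥0∞) ^ ((3 / 2 : ℝ) - 1) ≤ 2 := by
    conv_rhs => rw [← ENNReal.rpow_one 2]
    exact ENNReal.rpow_le_rpow_of_exponent_le (by norm_num) (by norm_num)
  have h256 : (256 : ℝ≥0∞) ^ (3 / 2 : ℝ) = 4096 := by
    rw [show (256 : ℝ≥0∞) = ENNReal.ofReal 256 by norm_num,
      ENNReal.ofReal_rpow_of_pos (by norm_num), show (256 : ℝ) = 16 ^ 2 by norm_num,
      ← Real.rpow_natCast 16 2, ← Real.rpow_mul (by norm_num)]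
    norm_num
  have hA32 : ENNReal.ofReal (CB * m ^ 2 / rn ^ 3) ^ (3 / 2 : ℝ) ≤
      ENNReal.ofReal (CB ^ 2 * m ^ 3 / ρ ^ 9) := by
    rw [ENNReal.ofReal_rpow_of_nonneg (by positivity) (by norm_num)]
    refine ENNReal.ofReal_le_ofReal ?_
    set lam : ℝ := Real.sqrt CB with hlam
    have hlam2 : lam ^ 2 = CB := Real.sq_sqrt hCB0.le
    have hlam1 : 1 ≤ lam := by
      rw [hlam, Real.one_le_sqrt]; exact hCB
    have hrn3 : rn ^ 3 = ρ ^ 6 := by rw [← hρ2]; ring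
    have e : CB * m ^ 2 / rn ^ 3 = (lam * m / ρ ^ 3) ^ 2 := by
      rw [div_pow, mul_pow, hlam2, hrn3]; ring
    rw [e, ← Real.rpow_natCast _ 2, ← Real.rpow_mul (by positivity),
      show ((2 : ℕ) : ℝ) * (3 / 2) = ((3 : ℕ) : ℝ) by norm_num, Real.rpow_natCast, div_pow, mul_pow]
    have hlam3 : lam ^ 3 ≤ CB ^ 2 := by
      have h1 : lam ≤ lam ^ 2 := le_self_pow₀ hlam1 two_ne_zero
      have h2 : lam ^ 3 = CB * lam := by rw [pow_succ, hlam2]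
      rw [h2]
      have h3 : lam ≤ CB := by rw [← hlam2]; exact h1
      nlinarith
    have hρ9 : 0 < (ρ ^ 3) ^ 3 := by positivity
    rw [show (ρ ^ 3) ^ 3 = ρ ^ 9 by ring] at hρ9 ⊢
    exact div_le_div_of_nonneg_right (mul_le_mul_of_nonneg_right hlam3 (pow_pos hm0 3).le)
      hρ9.le
  have hkey : ∀ᵐ t ∂(volume.restrict In),
      ∫⁻ x in ball z.2 rn, ‖p t x - ⨍ y in ball z.2 rn, p t y‖ₑ ^ (3 / 2 : ℝ) ≤
        ENNReal.ofReal C₂ * (∫⁻ x in ball z.2 (2 * rn), ‖u t x‖ₑ ^ (3 : ℕ)) +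
        ENNReal.ofReal C₂ * ENNReal.ofReal (ρ ^ 9) *
          (2 * ENNReal.ofReal (CB ^ 2 * m ^ 3 / ρ ^ 9)) +
        ENNReal.ofReal C₂ * ENNReal.ofReal (ρ ^ 9) * (2 * 4096 + 32) *
          ∫⁻ x in ball z.2 (1 / 2), (‖u t x‖ₑ ^ (3 : ℕ) + ‖p t x‖ₑ ^ (3 / 2 : ℝ)) := by
    have hslice' : ∀ᵐ t ∂(volume.restrict In), ∀ j : ℕ, 2 ≤ j → j ≤ n →
        t ∈ Ioo (z.1 - rad j ^ 2) z.1 →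
        ∫⁻ x in ball z.2 (rad j), ‖u t x‖ₑ ^ 2 ≤ ENNReal.ofReal (CB * m ^ 2 * rad j) :=
      ae_restrict_of_ae hslice
    filter_upwards [ae_restrict_of_ae_restrict_of_subset hInsub h12ae, hslice',
      ae_restrict_of_ae_restrict_of_subset hInsub hslm, ae_restrict_mem measurableSet_Ioo]
      with t h12t hslt hmt htIn
    set E : ℝ≥0∞ := ∫⁻ x in ball z.2 (1 / 2), ‖u t x‖ₑ ^ 2 with hE
    set W : ℝ≥0∞ := ∫⁻ x in ball z.2 (1 / 2), (‖u t x‖ₑ ^ (3 : ℕ) + ‖p t x‖ₑ ^ (3 / 2 : ℝ)) with hW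
    -- slices at time `t` inherit the bounds `(B'_j)`, `2 ≤ j ≤ n`
    have hballj : ∀ j, 2 ≤ j → j ≤ n →
        ∫⁻ x in ball z.2 (rad j), ‖u t x‖ₑ ^ 2 ≤ ENNReal.ofReal (CB * m ^ 2 * rad j) := by
      intro j hj2 hjn
      refine hslt j hj2 hjn ⟨?_, htIn.2⟩
      have : rn ≤ rad j := rad_antitone hjn
      have h1 := htIn.1
      nlinarith [rad_pos j]
    -- the tail: rings `2 ≤ j ≤ n - 2` by `(B'_j)`, the outermost ring by the energy on `B_{1/2}`
    have hT : ∫⁻ y in {y : (EuclideanSpace ℝ (Fin 3)) | 2 * rn < dist y z.2 ∧ dist y z.2 < 1 / 2},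
        ‖u t y‖ₑ ^ 2 / ENNReal.ofReal (dist y z.2 ^ 4) ≤
        ENNReal.ofReal (CB * m ^ 2 / rn ^ 3) + 256 * E := by
      rw [← hrad_pred]
      refine (lintegral_annulus_le_sum_rings z.2 hn (u t)).trans ?_
      rcases Nat.lt_or_ge 1 (n - 1) with h1n | h1n
      · rw [Finset.sum_eq_sum_Ico_succ_bot h1n]
        have hring1 : ∫⁻ y in {y : (EuclideanSpace ℝ (Fin 3)) | rad (1 + 1) ≤ dist y z.2 ∧ dist y z.2 < rad 1},
            ‖u t y‖ₑ ^ 2 / ENNReal.ofReal (dist y z.2 ^ 4) ≤ 256 * E := by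
          refine (lintegral_ring_weight_le z.2 1 (u t)).trans ?_
          rw [rad_one, show (1 : ℕ) + 1 = 2 from rfl, rad_two]
          have : (ENNReal.ofReal ((1 / 4 : ℝ) ^ 4))⁻¹ = 256 := by
            rw [← ENNReal.ofReal_inv_of_pos (by norm_num)]; norm_num
          rw [this]
        have hrings : ∑ j ∈ Finset.Ico 2 (n - 1),
            ∫⁻ y in {y : (EuclideanSpace ℝ (Fin 3)) | rad (j + 1) ≤ dist y z.2 ∧ dist y z.2 < rad j},
              ‖u t y‖ₑ ^ 2 / ENNReal.ofReal (dist y z.2 ^ 4) ≤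
            ENNReal.ofReal (CB * m ^ 2 / rn ^ 3) := by
          calc ∑ j ∈ Finset.Ico 2 (n - 1),
                ∫⁻ y in {y : (EuclideanSpace ℝ (Fin 3)) | rad (j + 1) ≤ dist y z.2 ∧ dist y z.2 < rad j},
                  ‖u t y‖ₑ ^ 2 / ENNReal.ofReal (dist y z.2 ^ 4)
              ≤ ∑ j ∈ Finset.Ico 2 (n - 1), ENNReal.ofReal (16 * CB * m ^ 2 * 8 ^ j) := by
                refine Finset.sum_le_sum fun j hj => ?_
                obtain ⟨hj2, hjn⟩ := Finset.mem_Ico.1 hj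
                refine (lintegral_ring_weight_le z.2 j (u t)).trans ?_
                calc (ENNReal.ofReal (rad (j + 1) ^ 4))⁻¹ * ∫⁻ y in ball z.2 (rad j), ‖u t y‖ₑ ^ 2
                    ≤ (ENNReal.ofReal (rad (j + 1) ^ 4))⁻¹ * ENNReal.ofReal (CB * m ^ 2 * rad j) := by
                      gcongr
                      exact hballj j hj2 (by omega)
                  _ = ENNReal.ofReal (16 * CB * m ^ 2 * 8 ^ j) := by
                      rw [← ENNReal.ofReal_inv_of_pos (pow_pos (rad_pos _) 4),
                        ← ENNReal.ofReal_mul (inv_nonneg.2 (pow_nonneg (rad_pos _).le 4))]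
                      congr 1
                      have hr := rad_pos j
                      have hinv : (rad j)⁻¹ = 2 ^ j := by rw [rad, ← inv_pow]; norm_num
                      have e1 : ((rad (j + 1)) ^ 4)⁻¹ * (CB * m ^ 2 * rad j) =
                          16 * CB * m ^ 2 * ((rad j)⁻¹) ^ 3 := by
                        rw [rad_succ]; field_simp; ring
                      rw [e1, hinv, ← pow_mul, show (2 : ℝ) ^ (j * 3) = 8 ^ j by
                        rw [mul_comm, pow_mul]; norm_num]
            _ = ENNReal.ofReal (∑ j ∈ Finset.Ico 2 (n - 1), 16 * CB * m ^ 2 * 8 ^ j) :=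
                (ENNReal.ofReal_sum_of_nonneg (fun j _ => by positivity)).symm
            _ ≤ ENNReal.ofReal (CB * m ^ 2 / rn ^ 3) := by
                refine ENNReal.ofReal_le_ofReal ?_
                rw [← Finset.mul_sum]
                have hs := sum_Ico_eight_pow_le (n - 1)
                have h8n : (8 : ℝ) ^ (n - 1) = 1 / (8 * rn ^ 3) := by
                  have h2 : (2 : ℝ) ^ (n - 1) = 1 / rad (n - 1) := by
                    rw [rad, one_div, ← inv_pow, one_div, inv_inv]
                  calc (8 : ℝ) ^ (n - 1) = ((2 : ℝ) ^ (n - 1)) ^ 3 := by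
                        rw [← pow_mul, mul_comm, pow_mul]; norm_num
                    _ = (1 / rad (n - 1)) ^ 3 := by rw [h2]
                    _ = 1 / (8 * rn ^ 3) := by rw [hrad_pred]; field_simp; ring
                rw [h8n] at hs
                have hrn3 : 0 < rn ^ 3 := pow_pos hrn0 3
                calc 16 * CB * m ^ 2 * ∑ j ∈ Finset.Ico 2 (n - 1), (8 : ℝ) ^ j
                    ≤ 16 * CB * m ^ 2 * (1 / (8 * rn ^ 3) / 7) := by gcongr
                  _ = (2 / 7) * (CB * m ^ 2 / rn ^ 3) := by field_simp; ring
                  _ ≤ 1 * (CB * m ^ 2 / rn ^ 3) := by gcongr; norm_num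
                  _ = CB * m ^ 2 / rn ^ 3 := one_mul _
        calc _ ≤ 256 * E + ENNReal.ofReal (CB * m ^ 2 / rn ^ 3) := add_le_add hring1 hrings
          _ = _ := add_comm _ _
      · have : Finset.Ico 1 (n - 1) = ∅ := Finset.Ico_eq_empty_of_le h1n
        rw [this, Finset.sum_empty]
        exact zero_le
    -- `(256 E)^{3/2} ≤ 4096 ∫_{B_{1/2}} |u(t)|³ ≤ 4096 W`
    have hE32 : (256 * E) ^ (3 / 2 : ℝ) ≤ 4096 * W := by
      rw [ENNReal.mul_rpow_of_nonneg _ _ (by norm_num), h256]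
      gcongr
      calc E ^ (3 / 2 : ℝ) ≤ ∫⁻ x in ball z.2 (1 / 2), ‖u t x‖ₑ ^ (3 : ℕ) :=
            lintegral_sq_rpow_le_lintegral_cube z.2 hmt.enorm
        _ ≤ W := lintegral_mono fun x => le_self_add
    have hT32 : (∫⁻ y in {y : (EuclideanSpace ℝ (Fin 3)) | 2 * rn < dist y z.2 ∧ dist y z.2 < 1 / 2},
        ‖u t y‖ₑ ^ 2 / ENNReal.ofReal (dist y z.2 ^ 4)) ^ (3 / 2 : ℝ) ≤
        2 * (ENNReal.ofReal (CB ^ 2 * m ^ 3 / ρ ^ 9) + 4096 * W) := by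
      calc _ ≤ (ENNReal.ofReal (CB * m ^ 2 / rn ^ 3) + 256 * E) ^ (3 / 2 : ℝ) :=
            ENNReal.rpow_le_rpow hT (by norm_num)
        _ ≤ 2 ^ ((3 / 2 : ℝ) - 1) * (ENNReal.ofReal (CB * m ^ 2 / rn ^ 3) ^ (3 / 2 : ℝ) +
              (256 * E) ^ (3 / 2 : ℝ)) := ENNReal.rpow_add_le_mul_rpow_add_rpow _ _ (by norm_num)
        _ ≤ 2 * (ENNReal.ofReal (CB ^ 2 * m ^ 3 / ρ ^ 9) + 4096 * W) := by
            gcongr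
    -- the third coefficient: `r_n^{9/2} / (1/2)^{9/2} ≤ 32 ρ⁹`
    have hcoef3 : ENNReal.ofReal (rn ^ (9 / 2 : ℝ) / (1 / 2 : ℝ) ^ (9 / 2 : ℝ)) ≤
        ENNReal.ofReal (ρ ^ 9) * 32 := by
      rw [show (32 : ℝ≥0∞) = ENNReal.ofReal 32 by norm_num, ← ENNReal.ofReal_mul (by positivity)]
      refine ENNReal.ofReal_le_ofReal ?_
      rw [hrn_92]
      have h32 : (1 / 32 : ℝ) ≤ (1 / 2 : ℝ) ^ (9 / 2 : ℝ) := by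
        have : (1 / 2 : ℝ) ^ (5 : ℝ) ≤ (1 / 2 : ℝ) ^ (9 / 2 : ℝ) :=
          Real.rpow_le_rpow_of_exponent_ge (by norm_num) (by norm_num) (by norm_num)
        refine le_trans (le_of_eq ?_) this
        rw [show (5 : ℝ) = ((5 : ℕ) : ℝ) by norm_num, Real.rpow_natCast]; norm_num
      rw [div_le_iff₀ (lt_of_lt_of_le (by norm_num) h32)]
      have hρ9 : 0 ≤ ρ ^ 9 := by positivity
      nlinarith
    have hcoef2 : ENNReal.ofReal (rn ^ (9 / 2 : ℝ)) = ENNReal.ofReal (ρ ^ 9) := by rw [hrn_92]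
    -- assemble the slice bound
    calc ∫⁻ x in ball z.2 rn, ‖p t x - ⨍ y in ball z.2 rn, p t y‖ₑ ^ (3 / 2 : ℝ)
        ≤ ENNReal.ofReal C₂ * (∫⁻ x in ball z.2 (2 * rn), ‖u t x‖ₑ ^ (3 : ℕ)) +
          ENNReal.ofReal C₂ * ENNReal.ofReal (rn ^ (9 / 2 : ℝ)) *
            (∫⁻ y in {y : (EuclideanSpace ℝ (Fin 3)) | 2 * rn < dist y z.2 ∧ dist y z.2 < 1 / 2},
              ‖u t y‖ₑ ^ 2 / ENNReal.ofReal (dist y z.2 ^ 4)) ^ (3 / 2 : ℝ) +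
          ENNReal.ofReal C₂ * ENNReal.ofReal (rn ^ (9 / 2 : ℝ) / (1 / 2 : ℝ) ^ (9 / 2 : ℝ)) * W :=
          h12t
      _ ≤ ENNReal.ofReal C₂ * (∫⁻ x in ball z.2 (2 * rn), ‖u t x‖ₑ ^ (3 : ℕ)) +
          ENNReal.ofReal C₂ * ENNReal.ofReal (ρ ^ 9) *
            (2 * (ENNReal.ofReal (CB ^ 2 * m ^ 3 / ρ ^ 9) + 4096 * W)) +
          ENNReal.ofReal C₂ * (ENNReal.ofReal (ρ ^ 9) * 32) * W := by
          rw [hcoef2]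
          gcongr
      _ = _ := by ring
  -- (5) integrate the slice bound over `(s - r_n², s)`
  have hmeasOsc : AEMeasurable
      (fun w : ℝ × (EuclideanSpace ℝ (Fin 3)) => ‖p w.1 w.2 - ⨍ y in ball z.2 rn, p w.1 y‖ₑ ^ (3 / 2 : ℝ))
      (volume.restrict (parabolicCylinder rn z)) := by
    have hprn : AEStronglyMeasurable (uncurry p) (volume.restrict (parabolicCylinder rn z)) :=
      hp1.mono_measure (hres hrn0 (by linarith))
    exact ((hprn.sub (aestronglyMeasurable_setAverage_fst hprn)).enorm.pow_const _)
  have hU2meas : AEMeasurable (fun t => ∫⁻ x in ball z.2 (2 * rn), ‖u t x‖ₑ ^ (3 : ℕ))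
      (volume.restrict In) := by
    have hsub : In ×ˢ ball z.2 (2 * rn) ⊆ parabolicCylinder 1 z₀ := by
      refine subset_trans ?_ (hzQ (r := 2 * rn) (by positivity) (by linarith))
      exact prod_mono (Ioo_subset_Ioo (by nlinarith) le_rfl) Subset.rfl
    have h1 : AEMeasurable (fun w : ℝ × (EuclideanSpace ℝ (Fin 3)) => ‖u w.1 w.2‖ₑ ^ (3 : ℕ))
        ((volume.restrict In).prod (volume.restrict (ball z.2 (2 * rn)))) := by
      rw [Measure.prod_restrict, ← Measure.volume_eq_prod]
      exact (hu1.mono_measure (Measure.restrict_mono hsub le_rfl)).enorm.pow_const _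
    exact h1.lintegral_prod_right'
  have hWmeas : AEMeasurable
      (fun t => ∫⁻ x in ball z.2 (1 / 2), (‖u t x‖ₑ ^ (3 : ℕ) + ‖p t x‖ₑ ^ (3 / 2 : ℝ)))
      (volume.restrict In) := by
    have hsub : In ×ˢ ball z.2 (1 / 2) ⊆ parabolicCylinder 1 z₀ :=
      subset_trans (prod_mono hInsub Subset.rfl) (hzQ (by norm_num) le_rfl)
    have h1 : AEMeasurable (fun w : ℝ × (EuclideanSpace ℝ (Fin 3)) => ‖u w.1 w.2‖ₑ ^ (3 : ℕ) + ‖p w.1 w.2‖ₑ ^ (3 / 2 : ℝ))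
        ((volume.restrict In).prod (volume.restrict (ball z.2 (1 / 2)))) := by
      rw [Measure.prod_restrict, ← Measure.volume_eq_prod]
      exact ((hu1.mono_measure (Measure.restrict_mono hsub le_rfl)).enorm.pow_const _).add
        ((hp1.mono_measure (Measure.restrict_mono hsub le_rfl)).enorm.pow_const _)
    exact h1.lintegral_prod_right'
  -- the three integrated pieces
  have hInt1 : ∫⁻ t in In, ∫⁻ x in ball z.2 (2 * rn), ‖u t x‖ₑ ^ (3 : ℕ) ≤
      ENNReal.ofReal (K₁ * m ^ 3 * rn ^ 2) := by
    have hsub : In ×ˢ ball z.2 (2 * rn) ⊆ parabolicCylinder (rad (n - 1)) z := by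
      rw [hrad_pred]
      refine prod_mono (Ioo_subset_Ioo (by nlinarith) le_rfl) Subset.rfl
    have hmeas : AEMeasurable (fun w : ℝ × (EuclideanSpace ℝ (Fin 3)) => ‖u w.1 w.2‖ₑ ^ (3 : ℕ))
        (volume.restrict (parabolicCylinder (rad (n - 1)) z)) :=
      (hu1.mono_measure (hres (rad_pos _) (by rw [hrad_pred]; linarith))).enorm.pow_const _
    refine (lintegral_lintegral_le_of_prod_subset hsub hmeas).trans ?_
    rcases Nat.lt_or_ge 2 n with h3n | h2n
    · -- `n ≥ 3`: use `C(r_{n-1})`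
      rw [lintegral_cube_eq_mul_cknC (rad_pos _)]
      calc ENNReal.ofReal (rad (n - 1)) ^ 2 * cknC (rad (n - 1)) z u
          ≤ ENNReal.ofReal (rad (n - 1)) ^ 2 * ENNReal.ofReal (c₀ * CB ^ 2 * m ^ 3) := by
            gcongr
            exact hCk (n - 1) (by omega) (by omega)
        _ = ENNReal.ofReal (4 * c₀ * CB ^ 2 * m ^ 3 * rn ^ 2) := by
            rw [← ENNReal.ofReal_pow (rad_pos _).le, ← ENNReal.ofReal_mul (by positivity),
              hrad_pred]
            congr 1; ring
        _ ≤ ENNReal.ofReal (K₁ * m ^ 3 * rn ^ 2) := by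
            refine ENNReal.ofReal_le_ofReal ?_
            rw [hK₁]
            nlinarith [pow_pos hm0 3, pow_pos hrn0 2]
    · -- `n = 2`: use the smallness hypothesis directly
      obtain rfl : n = 2 := le_antisymm h2n hn
      calc ∫⁻ w in parabolicCylinder (rad (2 - 1)) z, ‖u w.1 w.2‖ₑ ^ (3 : ℕ)
          ≤ ∫⁻ w in parabolicCylinder 1 z₀, (‖u w.1 w.2‖ₑ ^ (3 : ℕ) + ‖p w.1 w.2‖ₑ ^ (3 / 2 : ℝ)) :=
            (lintegral_mono_set (hzQ (rad_pos _) (by rw [show 2 - 1 = 1 from rfl, rad_one]))).trans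
              (lintegral_mono fun w => le_self_add)
        _ ≤ ENNReal.ofReal ε₀ := hsmall
        _ ≤ ENNReal.ofReal (K₁ * m ^ 3 * rn ^ 2) := by
            refine ENNReal.ofReal_le_ofReal ?_
            rw [← hm3, hK₁, hrn, rad_two]
            nlinarith [pow_pos hm0 3, mul_pos hc₀0 (pow_pos hCB0 2)]
  have hInt3 : ∫⁻ t in In, ∫⁻ x in ball z.2 (1 / 2), (‖u t x‖ₑ ^ (3 : ℕ) + ‖p t x‖ₑ ^ (3 / 2 : ℝ)) ≤
      ENNReal.ofReal (m ^ 3) := by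
    have hsub : In ×ˢ ball z.2 (1 / 2) ⊆ parabolicCylinder 1 z₀ :=
      subset_trans (prod_mono hInsub Subset.rfl) (hzQ (by norm_num) le_rfl)
    have hmeas : AEMeasurable (fun w : ℝ × (EuclideanSpace ℝ (Fin 3)) => ‖u w.1 w.2‖ₑ ^ (3 : ℕ) + ‖p w.1 w.2‖ₑ ^ (3 / 2 : ℝ))
        (volume.restrict (parabolicCylinder 1 z₀)) :=
      (hu1.enorm.pow_const _).add (hp1.enorm.pow_const _)
    rw [hm3]
    exact (lintegral_lintegral_le_of_prod_subset hsub hmeas).trans hsmall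
  have hvolIn : volume In = ENNReal.ofReal (ρ ^ 4) := by
    rw [hIn, Real.volume_Ioo, ← hρ2]; congr 1; ring
  have hOsc : ∫⁻ w in parabolicCylinder rn z, ‖p w.1 w.2 - ⨍ y in ball z.2 rn, p w.1 y‖ₑ ^ (3 / 2 : ℝ) ≤
      ENNReal.ofReal (C₂ * K * m ^ 3 * ρ ^ 4) := by
    refine (lintegral_parabolicCylinder_le_of_ae_slice hmeasOsc hkey).trans ?_
    rw [lintegral_add_left' ((hU2meas.const_mul _).add_const _), lintegral_add_left'
      (hU2meas.const_mul _), lintegral_const_mul'' _ hU2meas, lintegral_const,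
      Measure.restrict_apply_univ, hvolIn, lintegral_const_mul'' _ hWmeas]
    calc ENNReal.ofReal C₂ * (∫⁻ t in In, ∫⁻ x in ball z.2 (2 * rn), ‖u t x‖ₑ ^ (3 : ℕ)) +
          ENNReal.ofReal C₂ * ENNReal.ofReal (ρ ^ 9) * (2 * ENNReal.ofReal (CB ^ 2 * m ^ 3 / ρ ^ 9)) *
            ENNReal.ofReal (ρ ^ 4) +
          ENNReal.ofReal C₂ * ENNReal.ofReal (ρ ^ 9) * (2 * 4096 + 32) *
            ∫⁻ t in In, ∫⁻ x in ball z.2 (1 / 2), (‖u t x‖ₑ ^ (3 : ℕ) + ‖p t x‖ₑ ^ (3 / 2 : ℝ))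
        ≤ ENNReal.ofReal C₂ * ENNReal.ofReal (K₁ * m ^ 3 * rn ^ 2) +
          ENNReal.ofReal C₂ * ENNReal.ofReal (ρ ^ 9) * (2 * ENNReal.ofReal (CB ^ 2 * m ^ 3 / ρ ^ 9)) *
            ENNReal.ofReal (ρ ^ 4) +
          ENNReal.ofReal C₂ * ENNReal.ofReal (ρ ^ 9) * (2 * 4096 + 32) * ENNReal.ofReal (m ^ 3) := by
          gcongr
      _ = ENNReal.ofReal (C₂ * (K₁ * m ^ 3 * rn ^ 2) +
            C₂ * ρ ^ 9 * (2 * (CB ^ 2 * m ^ 3 / ρ ^ 9)) * ρ ^ 4 +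
            C₂ * ρ ^ 9 * (2 * 4096 + 32) * m ^ 3) := by
          have T1 : ENNReal.ofReal C₂ * ENNReal.ofReal (K₁ * m ^ 3 * rn ^ 2) =
              ENNReal.ofReal (C₂ * (K₁ * m ^ 3 * rn ^ 2)) := (ENNReal.ofReal_mul hC₂.le).symm
          have T2 : ENNReal.ofReal C₂ * ENNReal.ofReal (ρ ^ 9) *
              (2 * ENNReal.ofReal (CB ^ 2 * m ^ 3 / ρ ^ 9)) * ENNReal.ofReal (ρ ^ 4) =
              ENNReal.ofReal (C₂ * ρ ^ 9 * (2 * (CB ^ 2 * m ^ 3 / ρ ^ 9)) * ρ ^ 4) := by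
            rw [show (2 : ℝ≥0∞) = ENNReal.ofReal 2 by norm_num,
              ← ENNReal.ofReal_mul (p := (2 : ℝ)) (by norm_num),
              ← ENNReal.ofReal_mul (p := C₂) hC₂.le,
              ← ENNReal.ofReal_mul (p := C₂ * ρ ^ 9) (by positivity),
              ← ENNReal.ofReal_mul (p := C₂ * ρ ^ 9 * (2 * (CB ^ 2 * m ^ 3 / ρ ^ 9)))
                (by positivity)]
          have T3 : ENNReal.ofReal C₂ * ENNReal.ofReal (ρ ^ 9) * (2 * 4096 + 32) *
              ENNReal.ofReal (m ^ 3) = ENNReal.ofReal (C₂ * ρ ^ 9 * (2 * 4096 + 32) * m ^ 3) := by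
            rw [show (2 * 4096 + 32 : ℝ≥0∞) = ENNReal.ofReal (2 * 4096 + 32) by norm_num,
              ← ENNReal.ofReal_mul (p := C₂) hC₂.le,
              ← ENNReal.ofReal_mul (p := C₂ * ρ ^ 9) (by positivity),
              ← ENNReal.ofReal_mul (p := C₂ * ρ ^ 9 * (2 * 4096 + 32)) (by positivity)]
          rw [T1, T2, T3, ← ENNReal.ofReal_add (by positivity) (by positivity),
            ← ENNReal.ofReal_add (by positivity) (by positivity)]
      _ ≤ ENNReal.ofReal (C₂ * K * m ^ 3 * ρ ^ 4) := by
          refine ENNReal.ofReal_le_ofReal ?_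
          rw [← hρ2, hK]
          have e3 : (ρ ^ 2) ^ 2 = ρ ^ 4 := by ring
          have e2 : C₂ * ρ ^ 9 * (2 * (CB ^ 2 * m ^ 3 / ρ ^ 9)) * ρ ^ 4 =
              2 * C₂ * CB ^ 2 * m ^ 3 * ρ ^ 4 := by
            have hρ9 : ρ ^ 9 ≠ 0 := by positivity
            field_simp
          have h2 : ρ ^ 9 ≤ ρ ^ 4 := pow_le_pow_of_le_one hρ0.le hρ1 (by norm_num)
          rw [e2, e3]
          have hB : 0 ≤ C₂ * (2 * 4096 + 32) * m ^ 3 := by positivity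
          nlinarith [mul_nonneg hB (sub_nonneg.2 h2)]
  -- (6) the pressure part of `(A'_n)`
  have hP : cknDOsc rn z p ≤ ENNReal.ofReal (1 / 2 * m ^ 2) := by
    rw [cknDOsc]
    have hρ4 : ENNReal.ofReal rn ^ 2 = ENNReal.ofReal (ρ ^ 4) := by
      rw [← ENNReal.ofReal_pow hrn0.le, ← hρ2]; congr 1; ring
    have h0 : ENNReal.ofReal (ρ ^ 4) ≠ 0 := (ENNReal.ofReal_pos.2 (by positivity)).ne'
    calc (ENNReal.ofReal rn ^ 2)⁻¹ *
          ∫⁻ w in parabolicCylinder rn z, ‖p w.1 w.2 - ⨍ y in ball z.2 rn, p w.1 y‖ₑ ^ (3 / 2 : ℝ)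
        ≤ (ENNReal.ofReal rn ^ 2)⁻¹ * ENNReal.ofReal (C₂ * K * m ^ 3 * ρ ^ 4) := by
          gcongr
      _ = ENNReal.ofReal (C₂ * K * m ^ 3) := by
          rw [hρ4, ENNReal.ofReal_mul (by positivity) (q := ρ ^ 4),
            mul_comm (ENNReal.ofReal (C₂ * K * m ^ 3)), ← mul_assoc,
            ENNReal.inv_mul_cancel h0 ENNReal.ofReal_ne_top, one_mul]
      _ ≤ ENNReal.ofReal (1 / 2 * m ^ 2) := by
          refine ENNReal.ofReal_le_ofReal ?_
          have hCK : 0 < 2 * C₂ * K := by positivity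
          have hm' : C₂ * K * m ≤ 1 / 2 := by
            rw [le_div_iff₀ hCK] at hm_p
            linarith
          nlinarith [pow_pos hm0 2]
  -- (7) the velocity part of `(A'_n)` and the conclusion
  have hU : cknC rn z u ≤ ENNReal.ofReal (1 / 2 * m ^ 2) := by
    refine (hCk n hn le_rfl).trans (ENNReal.ofReal_le_ofReal ?_)
    have hcc : 0 < 2 * c₀ * CB ^ 2 := by positivity
    have hm' : c₀ * CB ^ 2 * m ≤ 1 / 2 := by
      rw [le_div_iff₀ hcc] at hm_u
      linarith
    nlinarith [pow_pos hm0 2]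
  calc cknC (rad n) z u + cknDOsc (rad n) z p
      ≤ ENNReal.ofReal (1 / 2 * m ^ 2) + ENNReal.ofReal (1 / 2 * m ^ 2) := add_le_add hU hP
    _ = ENNReal.ofReal (ε₀ ^ (2 / 3 : ℝ)) := by
        rw [← ENNReal.ofReal_add (by positivity) (by positivity), hm2]
        ring_nf

/-- **Step 3 of the initial-time induction, unconditionally**: the interpolation inequality is the
discharged `interpolationEstimate_holds`; the pressure estimate is kept as the hypothesis
`RRS2016.lemma15_12` (discharged in `CKNLocalRegularityRRSPressure.lean`, which is imported only
by the final assembly). [cite: RobinsonRodrigoSadowski2016, proof of Thm. 15.3, Step 3, pp. 223–225] -/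
theorem initialStep3_of_lemma15_12 (h12 : lemma15_12) :
    ∀ CB : ℝ, 1 ≤ CB → ∃ ε₁ : ℝ, 0 < ε₁ ∧
      ∀ (z₀ : ℝ × EuclideanSpace ℝ (Fin 3))
        (u : ℝ → EuclideanSpace ℝ (Fin 3) → EuclideanSpace ℝ (Fin 3))
        (p : ℝ → EuclideanSpace ℝ (Fin 3) → ℝ)
        (G : ℝ → EuclideanSpace ℝ (Fin 3) → EuclideanSpace ℝ (Fin 3) →L[ℝ] EuclideanSpace ℝ (Fin 3)),
        HasWeakSpatialGradientOn (parabolicCylinderOpens 1 z₀) u G →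
        LocallyIntegrableOn (uncurry p) (parabolicCylinder 1 z₀) volume →
        (∀ φ : ℝ → EuclideanSpace ℝ (Fin 3) → ℝ, IsSpaceTimeTestOn (parabolicCylinderOpens 1 z₀) φ →
          ∫ w in parabolicCylinder 1 z₀,
            (⟪u w.1 w.2, convect (u w.1) (gradient (φ w.1)) w.2⟫ + p w.1 w.2 * Δ (φ w.1) w.2) = 0) →
        ∀ ε₀ : ℝ, 0 < ε₀ → ε₀ ≤ ε₁ → Small ε₀ u p z₀ →
          ∀ z ∈ parabolicCylinder (1 / 2) z₀, ∀ n : ℕ, 2 ≤ n →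
            (∀ k : ℕ, 2 ≤ k → k ≤ n →
              cknAEss (rad k) z u + cknE (rad k) z G ≤ ENNReal.ofReal (CB * ε₀ ^ (2 / 3 : ℝ))) →
            cknC (rad n) z u + cknDOsc (rad n) z p ≤ ENNReal.ofReal (ε₀ ^ (2 / 3 : ℝ)) :=
  initialStep3 interpolationEstimate_holds h12

end BarkerPrange2020

end Literature.Analysis.FluidPDE

end
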